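import Summits.NavierStokesRegularity.FunctionalMining.TopEigSimpleTopPersist
import HarnessLib

/-!
# FunctionalMining — a simple top eigenvalue is jointly `C^∞` in any number of parameters: the
# implicit-function step of F1 PART I, Proposition 3, with parameters in a Banach space

Search for candidate a priori estimates; no regularity claim. Cell `pub-nsfunc`, prove seat
(gen 23). `TopEigSmoothEigenpair.lean` / `TopEigSimpleTopPersist.lean` (gen 22) continue a simple top
eigenpair of a ONE-parameter family `θ ↦ S(θ)` of symmetric `3 × 3` matrices. Here the parameter runs
in an arbitrary real Banach space `E` (for the torus: `E = ℝ³`, the chart at a point), which is what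
the density identity on the open simple set needs (JOINT smoothness of `λ₁(S(v)(x))` in `x`).

* `TopEig.fderiv_comp_inr_eq_fderiv_slice` — the partial derivative of `f(θ, p)` in `p` is the
  derivative of the slice `p ↦ f(θ₀, p)`: it does not see the parameter space;
* `TopEig.isInvertible_fderiv_eigenpairSlice` / `TopEig.isInvertible_fderiv_inr_param` — hence the
  invertibility of the `(v, μ)`-derivative of the eigenpair map `(T(θ)v − μv, |v|²)` at a simple
  negative eigenpair of a signature-`(2,1)` point, proved in the tree for one real parameter
  (`Literature.Analysis.Matrix.isInvertible_fderiv_inr`, Perutz 2006 §2.3 (d) / Kato II-§5),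
  transfers verbatim to parameters in `E`;
* `TopEig.exists_contDiffAt_eigenpair_of_signature_param`,
  **`TopEig.exists_contDiffAt_top_eigenpair_param`** — at a simple top in gap form
  (`S(θ₀)e = λe`, `|e| = 1`, `wᵀS(θ₀)w ≤ (λ − g)|w|²` on `e^⊥`, `g > 0`) of an entrywise `C^∞` family
  `S : E → Sym₃(ℝ)` there is a local eigenpair `(N, Λ)`, `C^∞` at `θ₀`, through `(e, λ)`;
* `TopEig.eventually_top_eigenpair_of_continuousAt` — persistence (the continued pair is the top
  pair nearby, gap `g/2`) for ANY topological parameter space, from continuity at `θ₀` alone;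
* **`TopEig.contDiffAt_lam1_of_gapForm_param`** — consequently `θ ↦ λ₁(S(θ))` is `C^∞` at `θ₀`,
  coincides near `θ₀` with `Λ`, `N(θ)` is a unit top eigenvector of `S(θ)` and the gap form persists
  with gap `g/2` (so the simple set is open);
* `TopEig.fderiv_lam1_of_gapForm_param` — Hellmann–Feynman in `E`: `Dλ₁(S)(θ₀)h = eᵀ(DS(θ₀)h)e`.

[ours; folklore — Kato, Perturbation theory, II-§5.1 (a simple eigenvalue is as smooth as the family)]
-/

noncomputable section

open Filter Topology Matrix
open scoped ContDiff

namespace Summit.NavierStokesRegularity.FunctionalMining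

namespace TopEig

open Literature.Analysis.Matrix SharpClass.DirectorForm

/-! ## 1. The partial derivative in `(v, μ)` does not see the parameter space -/

section Slice

variable {E : Type*} [NormedAddCommGroup E] [NormedSpace ℝ E]
variable {P : Type*} [NormedAddCommGroup P] [NormedSpace ℝ P]
variable {G : Type*} [NormedAddCommGroup G] [NormedSpace ℝ G]

/-- **The partial derivative is the derivative of the slice**: for `f` differentiable at `(θ₀, p₀)`,
`Df(θ₀, p₀) ∘ (0, ·) = D(p ↦ f(θ₀, p))(p₀)`. [folklore] -/
theorem fderiv_comp_inr_eq_fderiv_slice {f : E × P → G} {θ₀ : E} {p₀ : P}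
    (hf : DifferentiableAt ℝ f (θ₀, p₀)) :
    fderiv ℝ f (θ₀, p₀) ∘L ContinuousLinearMap.inr ℝ E P = fderiv ℝ (fun p => f (θ₀, p)) p₀ := by
  have h := hf.hasFDerivAt.comp p₀ (hasFDerivAt_prodMk_right (𝕜 := ℝ) θ₀ p₀)
  exact h.fderiv.symm

end Slice

/-! ## 2. The eigenpair map with parameters in a normed space -/

section Param

variable {E : Type*} [NormedAddCommGroup E] [NormedSpace ℝ E]

/-- `(θ, v) ↦ S(θ) v` is `C^∞` for an entrywise `C^∞` family `S : E → Mat₃(ℝ)`. [folklore] -/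
theorem contDiff_mulVec_family_param {S : E → Matrix (Fin 3) (Fin 3) ℝ}
    (hS : ∀ i j, ContDiff ℝ ∞ fun θ => S θ i j) :
    ContDiff ℝ ∞ fun p : E × ((Fin 3 → ℝ) × ℝ) => S p.1 *ᵥ p.2.1 := by
  refine contDiff_pi.2 fun i => ?_
  have h : (fun p : E × ((Fin 3 → ℝ) × ℝ) => (S p.1 *ᵥ p.2.1) i) =
      fun p => ∑ j, S p.1 i j * p.2.1 j := by
    funext p; simp [Matrix.mulVec, dotProduct]
  rw [h]
  refine ContDiff.sum fun j _ => ((hS i j).comp contDiff_fst).mul ?_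
  exact contDiff_pi.1 (contDiff_fst.comp contDiff_snd) j

/-- The eigenpair map `f(θ; v, μ) = (S(θ)v − μv, |v|²)` is `C^∞` on `E × (ℝ³ × ℝ)`. [folklore] -/
theorem contDiff_eigenpairMap_param {S : E → Matrix (Fin 3) (Fin 3) ℝ}
    (hS : ∀ i j, ContDiff ℝ ∞ fun θ => S θ i j) :
    ContDiff ℝ ∞ fun p : E × ((Fin 3 → ℝ) × ℝ) =>
      (S p.1 *ᵥ p.2.1 - p.2.2 • p.2.1, p.2.1 ⬝ᵥ p.2.1) := by
  have hv : ContDiff ℝ ∞ fun p : E × ((Fin 3 → ℝ) × ℝ) => p.2.1 := contDiff_fst.comp contDiff_snd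
  have hμ : ContDiff ℝ ∞ fun p : E × ((Fin 3 → ℝ) × ℝ) => p.2.2 := contDiff_snd.comp contDiff_snd
  refine ((contDiff_mulVec_family_param hS).sub (hμ.smul hv)).prodMk ?_
  have h : (fun p : E × ((Fin 3 → ℝ) × ℝ) => p.2.1 ⬝ᵥ p.2.1) = fun p => ∑ i, p.2.1 i * p.2.1 i := by
    funext p; rfl
  rw [h]
  exact ContDiff.sum fun i _ => (contDiff_pi.1 hv i).mul (contDiff_pi.1 hv i)

/-- **Invertibility of the linearised eigenpair equation at a simple negative eigenpair** of a
signature-`(2,1)` symmetric matrix `T₀` (`T₀n = λn`, `|n| = 1`, `λ < 0`, `T₀ > 0` on `n^⊥`): the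
derivative of `(v, μ) ↦ (T₀v − μv, |v|²)` at `(n, λ)` is invertible. This is the tree's
one-parameter statement `Literature.Analysis.Matrix.isInvertible_fderiv_inr` read on the constant
family. [cite: Perutz2006, §2.3 (d)] -/
theorem isInvertible_fderiv_eigenpairSlice {T₀ : Matrix (Fin 3) (Fin 3) ℝ} {n : Fin 3 → ℝ} {lam : ℝ}
    (hsymm : T₀.IsSymm) (hn1 : n ⬝ᵥ n = 1) (hTn : T₀ *ᵥ n = lam • n) (hlam : lam < 0)
    (hpos : ∀ v, v ⬝ᵥ n = 0 → v ≠ 0 → 0 < v ⬝ᵥ T₀ *ᵥ v) :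
    (fderiv ℝ (fun p : (Fin 3 → ℝ) × ℝ => (T₀ *ᵥ p.1 - p.2 • p.1, p.1 ⬝ᵥ p.1)) (n, lam)).IsInvertible := by
  have hc : ∀ i j, ContDiff ℝ ∞ fun _ : ℝ => T₀ i j := fun _ _ => contDiff_const
  have hR : DifferentiableAt ℝ (fun p : ℝ × ((Fin 3 → ℝ) × ℝ) =>
      ((fun _ : ℝ => T₀) p.1 *ᵥ p.2.1 - p.2.2 • p.2.1, p.2.1 ⬝ᵥ p.2.1)) ((0 : ℝ), (n, lam)) :=
    ((contDiff_eigenpairMap hc).differentiable (by simp)) _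
  have hinv : (fderiv ℝ (fun p : ℝ × ((Fin 3 → ℝ) × ℝ) =>
      ((fun _ : ℝ => T₀) p.1 *ᵥ p.2.1 - p.2.2 • p.2.1, p.2.1 ⬝ᵥ p.2.1)) ((0 : ℝ), (n, lam)) ∘L
        ContinuousLinearMap.inr ℝ ℝ ((Fin 3 → ℝ) × ℝ)).IsInvertible :=
    isInvertible_fderiv_inr (T := fun _ : ℝ => T₀) hc hsymm hn1 hTn hlam hpos
  have hslice := fderiv_comp_inr_eq_fderiv_slice hR
  rw [hslice] at hinv
  exact hinv

/-- **Invertibility of the `(v, μ)`-derivative of the eigenpair map with parameters in `E`** at a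
simple negative eigenpair of a signature-`(2,1)` point. [cite: Perutz2006, §2.3 (d)] -/
theorem isInvertible_fderiv_inr_param {T : E → Matrix (Fin 3) (Fin 3) ℝ}
    (hT : ∀ i j, ContDiff ℝ ∞ fun θ => T θ i j) {θ₀ : E} {n : Fin 3 → ℝ} {lam : ℝ}
    (hsymm : (T θ₀).IsSymm) (hn1 : n ⬝ᵥ n = 1) (hTn : T θ₀ *ᵥ n = lam • n) (hlam : lam < 0)
    (hpos : ∀ v, v ⬝ᵥ n = 0 → v ≠ 0 → 0 < v ⬝ᵥ T θ₀ *ᵥ v) :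
    (fderiv ℝ (fun p : E × ((Fin 3 → ℝ) × ℝ) =>
        (T p.1 *ᵥ p.2.1 - p.2.2 • p.2.1, p.2.1 ⬝ᵥ p.2.1)) (θ₀, (n, lam)) ∘L
      ContinuousLinearMap.inr ℝ E ((Fin 3 → ℝ) × ℝ)).IsInvertible := by
  have hE : DifferentiableAt ℝ (fun p : E × ((Fin 3 → ℝ) × ℝ) =>
      (T p.1 *ᵥ p.2.1 - p.2.2 • p.2.1, p.2.1 ⬝ᵥ p.2.1)) (θ₀, (n, lam)) :=
    ((contDiff_eigenpairMap_param hT).differentiable (by simp)) _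
  rw [fderiv_comp_inr_eq_fderiv_slice hE]
  exact isInvertible_fderiv_eigenpairSlice hsymm hn1 hTn hlam hpos

variable [CompleteSpace E]

/-- **Local `C^∞` continuation of a simple negative eigenpair at a signature-`(2,1)` point, parameters
in a Banach space `E`.** Let `T : E → Mat₃(ℝ)` be entrywise `C^∞`, `T(θ₀)` symmetric, `T(θ₀)n = λn`
with `|n| = 1`, `λ < 0` and `T(θ₀) > 0` on `n^⊥`. Then there are `N, Λ`, `C^∞` at `θ₀`, with
`N(θ₀) = n`, `Λ(θ₀) = λ` and `T(θ)N(θ) = Λ(θ)N(θ)`, `|N(θ)| = 1` for all `θ` near `θ₀` (Mathlib's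
`C^n` implicit function theorem). [folklore — Kato II-§5; cite: Perutz2006, §2.3 (d)] -/
theorem exists_contDiffAt_eigenpair_of_signature_param {T : E → Matrix (Fin 3) (Fin 3) ℝ}
    (hT : ∀ i j, ContDiff ℝ ∞ fun θ => T θ i j) {θ₀ : E} {n : Fin 3 → ℝ} {lam : ℝ}
    (hsymm : (T θ₀).IsSymm) (hn1 : n ⬝ᵥ n = 1) (hTn : T θ₀ *ᵥ n = lam • n) (hlam : lam < 0)
    (hpos : ∀ v, v ⬝ᵥ n = 0 → v ≠ 0 → 0 < v ⬝ᵥ T θ₀ *ᵥ v) :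
    ∃ (N : E → Fin 3 → ℝ) (Λ : E → ℝ), ContDiffAt ℝ ∞ N θ₀ ∧ ContDiffAt ℝ ∞ Λ θ₀ ∧ N θ₀ = n ∧
      Λ θ₀ = lam ∧ ∀ᶠ θ in 𝓝 θ₀, T θ *ᵥ N θ = Λ θ • N θ ∧ N θ ⬝ᵥ N θ = 1 := by
  set f : E × ((Fin 3 → ℝ) × ℝ) → (Fin 3 → ℝ) × ℝ :=
    fun q => (T q.1 *ᵥ q.2.1 - q.2.2 • q.2.1, q.2.1 ⬝ᵥ q.2.1) with hf
  have hfs : ContDiff ℝ ∞ f := contDiff_eigenpairMap_param hT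
  set u : E × ((Fin 3 → ℝ) × ℝ) := (θ₀, (n, lam)) with hu
  have cdf : ContDiffAt ℝ ∞ f u := hfs.contDiffAt
  have pn : (∞ : WithTop ℕ∞) ≠ 0 := by simp
  have if₂ : (fderiv ℝ f u ∘L ContinuousLinearMap.inr ℝ E ((Fin 3 → ℝ) × ℝ)).IsInvertible :=
    isInvertible_fderiv_inr_param hT hsymm hn1 hTn hlam hpos
  set ψ := cdf.implicitFunction pn if₂ with hψ
  have hψs : ContDiffAt ℝ ∞ ψ θ₀ := cdf.contDiffAt_implicitFunction pn if₂
  have hψ0 : ψ θ₀ = (n, lam) := cdf.implicitFunction_apply_self pn if₂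
  have hfu : f u = (0, 1) := by
    simp only [hf, hu]
    rw [hTn, sub_self, hn1]
  have hev : ∀ᶠ θ in 𝓝 θ₀, f (θ, ψ θ) = (0, 1) := by
    rw [← hfu]
    exact cdf.eventually_apply_implicitFunction pn if₂
  refine ⟨fun θ => (ψ θ).1, fun θ => (ψ θ).2, hψs.fst, hψs.snd, by simp [hψ0], by simp [hψ0], ?_⟩
  filter_upwards [hev] with θ h
  simp only [hf, Prod.mk.injEq] at h
  exact ⟨sub_eq_zero.1 h.1, h.2⟩

/-- **A SIMPLE TOP EIGENVALUE HAS A JOINTLY SMOOTH LOCAL EIGENPAIR (parameters in a Banach space).**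
Let `S : E → Mat₃(ℝ)` be entrywise `C^∞` with `S(θ₀)` symmetric, `S(θ₀)e = λe`, `|e| = 1`, and the
gap form `wᵀS(θ₀)w ≤ (λ − g)|w|²` on `e^⊥` for some `g > 0`. Then there are `N, Λ`, `C^∞` at `θ₀`,
with `N(θ₀) = e`, `Λ(θ₀) = λ`, `S(θ)N(θ) = Λ(θ)N(θ)` and `|N(θ)| = 1` near `θ₀`. (Apply the previous
theorem to `T = (λ − g/2)𝟙 − S`.) [folklore — Kato II-§5; F1 PART I Prop. 3, the IFT step in `d`
parameters] -/
theorem exists_contDiffAt_top_eigenpair_param {S : E → Matrix (Fin 3) (Fin 3) ℝ}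
    (hS : ∀ i j, ContDiff ℝ ∞ fun θ => S θ i j) {θ₀ : E} {e : Fin 3 → ℝ} {lam g : ℝ}
    (hsymm : (S θ₀).IsSymm) (he1 : e ⬝ᵥ e = 1) (hSe : S θ₀ *ᵥ e = lam • e) (hg : 0 < g)
    (hgap : ∀ v, v ⬝ᵥ e = 0 → v ⬝ᵥ S θ₀ *ᵥ v ≤ (lam - g) * (v ⬝ᵥ v)) :
    ∃ (N : E → Fin 3 → ℝ) (Λ : E → ℝ), ContDiffAt ℝ ∞ N θ₀ ∧ ContDiffAt ℝ ∞ Λ θ₀ ∧ N θ₀ = e ∧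
      Λ θ₀ = lam ∧ ∀ᶠ θ in 𝓝 θ₀, S θ *ᵥ N θ = Λ θ • N θ ∧ N θ ⬝ᵥ N θ = 1 := by
  set c := lam - g / 2 with hc
  set T : E → Matrix (Fin 3) (Fin 3) ℝ := fun θ => c • (1 : Matrix (Fin 3) (Fin 3) ℝ) - S θ with hTdef
  have hT : ∀ i j, ContDiff ℝ ∞ fun θ => T θ i j := by
    intro i j
    simp only [hTdef, Matrix.sub_apply, Matrix.smul_apply, smul_eq_mul]
    exact contDiff_const.sub (hS i j)
  have hTsymm : (T θ₀).IsSymm := by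
    simp only [hTdef]
    exact (Matrix.isSymm_one.smul c).sub hsymm
  have hTmul : ∀ θ v, T θ *ᵥ v = c • v - S θ *ᵥ v := by
    intro θ v
    simp only [hTdef, Matrix.sub_mulVec, Matrix.smul_mulVec, Matrix.one_mulVec]
  have hTe : T θ₀ *ᵥ e = (c - lam) • e := by
    rw [hTmul, hSe, ← sub_smul]
  have hneg : c - lam < 0 := by rw [hc]; linarith
  have hpos : ∀ v, v ⬝ᵥ e = 0 → v ≠ 0 → 0 < v ⬝ᵥ T θ₀ *ᵥ v := by
    intro v hv hv0
    rw [hTmul, dotProduct_sub, dotProduct_smul, smul_eq_mul]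
    have h1 := hgap v hv
    have h2 : 0 < v ⬝ᵥ v := lt_of_le_of_ne (dotProduct_self_nonneg' v)
      (fun h => hv0 (dotProduct_self_eq_zero.1 h.symm))
    rw [hc]
    nlinarith
  obtain ⟨N, Λ, hN, hΛ, hN0, hΛ0, hev⟩ :=
    exists_contDiffAt_eigenpair_of_signature_param hT hTsymm he1 hTe hneg hpos
  refine ⟨N, fun θ => c - Λ θ, hN, contDiffAt_const.sub hΛ, hN0, ?_, ?_⟩
  · show c - Λ θ₀ = lam
    rw [hΛ0, hc]
    ring
  · filter_upwards [hev] with θ h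
    obtain ⟨h1, h2⟩ := h
    refine ⟨?_, h2⟩
    rw [hTmul] at h1
    rw [sub_smul]
    rw [sub_eq_iff_eq_add] at h1
    rw [h1]
    abel

end Param

/-! ## 3. Persistence from continuity at the base point, any topological parameter space -/

/-- **THE CONTINUED EIGENPAIR IS THE TOP PAIR NEARBY (any parameter space).** Let `X` be a
topological space, `S : X → Sym₃(ℝ)` with entries continuous AT `θ₀`, a simple top of `S(θ₀)` at `e`
in gap form with gap `g > 0`, and `N : X → ℝ³`, `Λ : X → ℝ` continuous at `θ₀` with `N(θ₀) = e`,
`Λ(θ₀) = λ` and `S(θ)N(θ) = Λ(θ)N(θ)`, `|N(θ)| = 1` near `θ₀`. Then for `θ` near `θ₀`: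
`λ₁(S(θ)) = Λ(θ)`, `N(θ) ∈ E(S(θ))`, and the gap form holds at `N(θ)` with gap `g/2`.
(Same algebra as `eventually_top_eigenpair`: `ray_perp_le_near`, `lam1_eq_of_near`.)
[folklore — Kato II-§5] -/
theorem eventually_top_eigenpair_of_continuousAt {X : Type*} [TopologicalSpace X]
    {S : X → Matrix (Fin 3) (Fin 3) ℝ} {θ₀ : X}
    (hS : ∀ i j, ContinuousAt (fun θ => S θ i j) θ₀) (hsymm : ∀ θ, (S θ).IsSymm)
    {e : Fin 3 → ℝ} {lam g : ℝ} (he1 : e ⬝ᵥ e = 1) (hSe : S θ₀ *ᵥ e = lam • e) (hg : 0 < g)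
    (hgap : ∀ v, v ⬝ᵥ e = 0 → v ⬝ᵥ S θ₀ *ᵥ v ≤ (lam - g) * (v ⬝ᵥ v))
    {N : X → Fin 3 → ℝ} {Λ : X → ℝ} (hN : ContinuousAt N θ₀) (hΛ : ContinuousAt Λ θ₀)
    (hN0 : N θ₀ = e) (hΛ0 : Λ θ₀ = lam)
    (hev : ∀ᶠ θ in 𝓝 θ₀, S θ *ᵥ N θ = Λ θ • N θ ∧ N θ ⬝ᵥ N θ = 1) :
    ∀ᶠ θ in 𝓝 θ₀, lam1 (S θ) = Λ θ ∧ N θ ∈ topEigSet (flat (S θ)) ∧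
      ∀ w, w ⬝ᵥ N θ = 0 → w ⬝ᵥ S θ *ᵥ w ≤ (Λ θ - g / 2) * (w ⬝ᵥ w) := by
  -- (1) `Λ` close to `λ`
  have h1 : ∀ᶠ θ in 𝓝 θ₀, |Λ θ - lam| < g / 8 := by
    have h := hΛ.eventually (Metric.ball_mem_nhds (Λ θ₀) (by positivity : (0 : ℝ) < g / 8))
    filter_upwards [h] with θ hθ
    rw [Real.dist_eq, hΛ0] at hθ
    exact hθ
  -- (2) entrywise closeness of `S`
  have hF : ContinuousAt (fun θ => ∑ i, ∑ j, |S θ i j - S θ₀ i j|) θ₀ := by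
    have h : ∀ i j, ContinuousAt (fun θ => |S θ i j - S θ₀ i j|) θ₀ := fun i j =>
      ((hS i j).sub continuousAt_const).abs
    unfold ContinuousAt at h ⊢
    exact tendsto_finsetSum _ fun i _ => tendsto_finsetSum _ fun j _ => h i j
  have h2 : ∀ᶠ θ in 𝓝 θ₀, ∑ i, ∑ j, |S θ i j - S θ₀ i j| < g / 8 := by
    have h := hF.eventually (Metric.ball_mem_nhds _ (by positivity : (0 : ℝ) < g / 8))
    filter_upwards [h] with θ hθ
    rw [Real.dist_eq] at hθ
    simp only [sub_self, abs_zero, Finset.sum_const_zero, sub_zero] at hθ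
    have h0 : 0 ≤ ∑ i, ∑ j, |S θ i j - S θ₀ i j| :=
      Finset.sum_nonneg fun i _ => Finset.sum_nonneg fun j _ => abs_nonneg _
    rwa [abs_of_nonneg h0] at hθ
  -- (3) `N` close to `e`
  have hG : ContinuousAt (fun θ => (N θ - e) ⬝ᵥ (N θ - e)) θ₀ := by
    have h : Continuous fun p : (Fin 3 → ℝ) => (p - e) ⬝ᵥ (p - e) :=
      (continuous_id.sub continuous_const).dotProduct (continuous_id.sub continuous_const)
    exact h.continuousAt.comp hN
  have h3 : ∀ᶠ θ in 𝓝 θ₀, (N θ - e) ⬝ᵥ (N θ - e) < 1 / 8 := by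
    have h := hG.eventually (Metric.ball_mem_nhds _ (by norm_num : (0 : ℝ) < 1 / 8))
    filter_upwards [h] with θ hθ
    rw [Real.dist_eq, hN0, sub_self] at hθ
    simp only [dotProduct_zero, sub_zero] at hθ
    exact lt_of_abs_lt hθ
  filter_upwards [h1, h2, h3, hev] with θ hθ1 hθ2 hθ3 hθ4
  obtain ⟨hSN, hN1⟩ := hθ4
  have hη : ∀ w : Fin 3 → ℝ, w ⬝ᵥ (S θ - S θ₀) *ᵥ w ≤ (g / 8) * (w ⬝ᵥ w) := by
    intro w
    have h := abs_ray_le_sum_abs (S θ - S θ₀) w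
    simp only [Matrix.sub_apply] at h
    exact (le_abs_self _).trans (h.trans (mul_le_mul_of_nonneg_right hθ2.le (dotProduct_self_nonneg' w)))
  have hle : lam - g + g * (1 / 8) + g / 8 ≤ Λ θ := by
    have := (abs_lt.1 hθ1).1
    linarith
  obtain ⟨hlam1, htop, hgap'⟩ := lam1_eq_of_near (hsymm θ₀) (hsymm θ) he1 hSe hg.le hgap hN1 hSN hη
    hθ3.le hle
  refine ⟨hlam1, htop, fun w hw => ?_⟩
  have h := hgap' w hw
  have hθ1' := (abs_lt.1 hθ1).1
  nlinarith [h, dotProduct_self_nonneg' w, hθ1']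

/-! ## 4. `θ ↦ λ₁(S(θ))` is `C^∞` at a simple point; Hellmann–Feynman in `E` -/

section Lam1

variable {E : Type*} [NormedAddCommGroup E] [NormedSpace ℝ E] [CompleteSpace E]

/-- **PROPOSITION 3, THE IMPLICIT-FUNCTION STEP IN `d` PARAMETERS.** Let `S : E → Sym₃(ℝ)` be entrywise
`C^∞` (`E` a real Banach space) with a simple top at `θ₀` in gap form (`S(θ₀)e = λe`, `|e| = 1`,
`wᵀS(θ₀)w ≤ (λ − g)|w|²` on `e^⊥`, `g > 0`). Then there is `N : E → ℝ³`, `C^∞` at `θ₀` with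
`N(θ₀) = e`, such that for `θ` near `θ₀`: `S(θ)N(θ) = λ₁(S(θ))N(θ)`, `|N(θ)| = 1`,
`N(θ) ∈ E(S(θ))`, the gap form holds at `N(θ)` with gap `g/2` (so `λ₁` stays simple — the simple set
is open); and **`θ ↦ λ₁(S(θ))` is `C^∞` at `θ₀`** (jointly in all parameters).
[ours; folklore — Kato II-§5; F1 PART I Prop. 3] -/
theorem contDiffAt_lam1_of_gapForm_param {S : E → Matrix (Fin 3) (Fin 3) ℝ}
    (hS : ∀ i j, ContDiff ℝ ∞ fun θ => S θ i j) (hsymm : ∀ θ, (S θ).IsSymm) {θ₀ : E}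
    {e : Fin 3 → ℝ} {lam g : ℝ} (he1 : e ⬝ᵥ e = 1) (hSe : S θ₀ *ᵥ e = lam • e) (hg : 0 < g)
    (hgap : ∀ v, v ⬝ᵥ e = 0 → v ⬝ᵥ S θ₀ *ᵥ v ≤ (lam - g) * (v ⬝ᵥ v)) :
    ∃ N : E → Fin 3 → ℝ, ContDiffAt ℝ ∞ N θ₀ ∧ N θ₀ = e ∧
      (∀ᶠ θ in 𝓝 θ₀, S θ *ᵥ N θ = lam1 (S θ) • N θ ∧ N θ ⬝ᵥ N θ = 1 ∧
        N θ ∈ topEigSet (flat (S θ)) ∧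
        ∀ w, w ⬝ᵥ N θ = 0 → w ⬝ᵥ S θ *ᵥ w ≤ (lam1 (S θ) - g / 2) * (w ⬝ᵥ w)) ∧
      ContDiffAt ℝ ∞ (fun θ => lam1 (S θ)) θ₀ := by
  obtain ⟨N, Λ, hN, hΛ, hN0, hΛ0, hev⟩ :=
    exists_contDiffAt_top_eigenpair_param hS (hsymm θ₀) he1 hSe hg hgap
  have hSc : ∀ i j, ContinuousAt (fun θ => S θ i j) θ₀ := fun i j => (hS i j).continuous.continuousAt
  have hpers := eventually_top_eigenpair_of_continuousAt hSc hsymm he1 hSe hg hgap hN.continuousAt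
    hΛ.continuousAt hN0 hΛ0 hev
  have heq : (fun θ => lam1 (S θ)) =ᶠ[𝓝 θ₀] Λ := hpers.mono fun θ h => h.1
  refine ⟨N, hN, hN0, ?_, hΛ.congr_of_eventuallyEq heq⟩
  filter_upwards [hev, hpers] with θ h1 h2
  obtain ⟨hSN, hN1⟩ := h1
  obtain ⟨hlam1, htop, hgap'⟩ := h2
  rw [hlam1]
  exact ⟨hSN, hN1, htop, hgap'⟩

/-- **HELLMANN–FEYNMAN IN `d` PARAMETERS.** Under the hypotheses of `contDiffAt_lam1_of_gapForm_param`,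
the derivative of `θ ↦ λ₁(S(θ))` at `θ₀` in the direction `h` is `eᵀ (DS(θ₀)h) e`, where
`DS(θ₀)h` is the matrix of entrywise derivatives `D(Sᵢⱼ)(θ₀)h`. (Restrict to the line `θ₀ + t h`
and use the one-parameter statement `hasDerivAt_lam1_of_gapForm`.) [ours; F1 PART I Prop. 3] -/
theorem fderiv_lam1_of_gapForm_param {S : E → Matrix (Fin 3) (Fin 3) ℝ}
    (hS : ∀ i j, ContDiff ℝ ∞ fun θ => S θ i j) (hsymm : ∀ θ, (S θ).IsSymm) {θ₀ : E}
    {e : Fin 3 → ℝ} {lam g : ℝ} (he1 : e ⬝ᵥ e = 1) (hSe : S θ₀ *ᵥ e = lam • e) (hg : 0 < g)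
    (hgap : ∀ v, v ⬝ᵥ e = 0 → v ⬝ᵥ S θ₀ *ᵥ v ≤ (lam - g) * (v ⬝ᵥ v)) (h : E) :
    fderiv ℝ (fun θ => lam1 (S θ)) θ₀ h =
      e ⬝ᵥ ((Matrix.of fun i j => fderiv ℝ (fun θ => S θ i j) θ₀ h) *ᵥ e) := by
  obtain ⟨-, -, -, -, hcd⟩ := contDiffAt_lam1_of_gapForm_param hS hsymm he1 hSe hg hgap
  -- the line family `t ↦ S(θ₀ + t h)`
  set L : ℝ → Matrix (Fin 3) (Fin 3) ℝ := fun t => S (θ₀ + t • h) with hL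
  have hline : ContDiff ℝ ∞ fun t : ℝ => θ₀ + t • h := contDiff_const.add (contDiff_id.smul contDiff_const)
  have hLs : ∀ i j, ContDiff ℝ ∞ fun t => L t i j := fun i j => (hS i j).comp hline
  have hLsymm : ∀ t, (L t).IsSymm := fun t => hsymm _
  have hL0 : L 0 = S θ₀ := by simp [hL]
  have hSe' : L 0 *ᵥ e = lam • e := by rw [hL0]; exact hSe
  have hgap' : ∀ v, v ⬝ᵥ e = 0 → v ⬝ᵥ L 0 *ᵥ v ≤ (lam - g) * (v ⬝ᵥ v) := by
    intro v hv; rw [hL0]; exact hgap v hv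
  obtain ⟨-, -, -, -, -, hHF, -, -⟩ := hasDerivAt_lam1_of_gapForm hLs hLsymm he1 hSe' hg hgap'
  -- entrywise derivatives of `L` at `0` are `D(Sᵢⱼ)(θ₀) h`
  have hlin : HasDerivAt (fun t : ℝ => θ₀ + t • h) h 0 := by
    simpa using ((hasDerivAt_id (0 : ℝ)).smul_const h).const_add θ₀
  have hd : ∀ i j, deriv (fun t => L t i j) 0 = fderiv ℝ (fun θ => S θ i j) θ₀ h := by
    intro i j
    have hdiff : DifferentiableAt ℝ (fun θ => S θ i j) (θ₀ + (0 : ℝ) • h) := by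
      rw [zero_smul, add_zero]
      exact ((hS i j).differentiable (by simp)) θ₀
    have hc := hdiff.hasFDerivAt.comp_hasDerivAt (0 : ℝ) hlin
    rw [zero_smul, add_zero] at hc
    exact hc.deriv
  have hM : (Matrix.of fun i j => deriv (fun t => L t i j) 0) =
      Matrix.of fun i j => fderiv ℝ (fun θ => S θ i j) θ₀ h := by
    ext i j; rw [Matrix.of_apply, Matrix.of_apply, hd]
  rw [hM] at hHF
  -- the same line derivative through the Fréchet derivative of `λ₁ ∘ S`
  have hdiff : DifferentiableAt ℝ (fun θ => lam1 (S θ)) (θ₀ + (0 : ℝ) • h) := by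
    rw [zero_smul, add_zero]
    exact hcd.differentiableAt (by simp)
  have hc := hdiff.hasFDerivAt.comp_hasDerivAt (0 : ℝ) hlin
  rw [zero_smul, add_zero] at hc
  exact hc.deriv.symm.trans hHF.deriv

end Lam1

end TopEig

end Summit.NavierStokesRegularity.FunctionalMining

end
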